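import Summits.CriticalPhenomena.CardyFormulaZ2.Theorems.CardyComplexConeEdgePrecompactShiftCouplingLocalityReduction
import Literature.Probability.Percolation.BondPercolationBlockIndependence
import Literature.Probability.Percolation.RussoFormula

/-!
# The local inner envelope (X1) already gives the uniform inner envelope
(line `qkz-strip-boundary-arm` of crux `CardyComplexCone.EdgePrecompact`, stmt-CriticalPhenomena-11387;
lead c2, reshape r4)

The registered stub `stub_localInnerEnvelopeUI` (X1) of the skeleton
`Cruxes/EdgePrecompact/Lines/qkz_strip_boundary_arm.lean` is stated in uniform-integrability TAIL form:
`∀ ε₁ > 0 ∃ ε' > 0` such that for every admissible datum `E`, corner `(v,f)`, radius `ρ ≥ E.δ` with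
`closedBall (δv) ρ ⊆ E.Ω` and every event `A` measurable OFF the ball `B(δv, ρ)` with `P(A) ≤ ε'`,
`‖E[F_{v,f} ; A]‖ ≤ ε₁ (E.δ/ρ)^{1/3}` (`F` the spin-`1/3` dart phase sum, `cornerObs = ∫ F`).

THINNING. For admissible `E` the domain `E.Ω` is bounded and the mesh positive, so there are lattice
edges as far from `Ω` as we please (`exists_farEdges`: `k` horizontal edges of the row `{x₁ = 0}` beyond
a large abscissa). For a finite set `K` of genuine lattice edges the event "all edges of `K` are open"
(i) has probability EXACTLY `2^{-|K|}` (`real_allOpen`), (ii) is measurable off any ball missing the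
midpoints of `K` (`measurableSet_comap_allOpen`), and (iii) when `K` avoids the edges of the discrete
domain `Ω_δ` it is INDEPENDENT of the phase sum `F`, which reads only those edges
(`medialExploration_inter_eq`), whence `E[F ; all open] = 2^{-|K|} · E[F]` (`setIntegral_allOpen_eq`,
Grimmett 1999 §2.2 via `bondPercolation_indep_edgeSigma`). Feeding this event with `2^{-k} ≤ ε'` to (X1)
at `ε₁ = 1` gives `2^{-k} ‖cornerObs‖ ≤ (E.δ/ρ)^{1/3}`:

* `innerEnvelope_of_localInnerEnvelopeUI` — (X1) ⇒ `∃ C, ‖cornerObs E E.δ v f‖ ≤ C (E.δ/ρ)^{1/3}` for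
  every admissible `E` (any bounded domain, any arcs), every corner and every ball
  `closedBall (δv) ρ ⊆ E.Ω`, `ρ ≥ E.δ`;
* `uniformInnerEnvelope_of_localInnerEnvelopeUI` — (X1) ⇒ `UniformInnerEnvelope` (the junction of the
  line: `‖cornerObs‖ ≤ C R^{-1/3}` at lattice depth `R ≥ 1` in a Jordan Dobrushin domain; take
  `ρ = Rδ/2` for `R ≥ 2`, and `‖cornerObs‖ ≤ 1` at `R = 1`).

Consequence for the skeleton (reshape r4): clause (i) of the crux follows from (X1) alone through the
landed `boundClause`; the stubs `stub_ipExact` (P1) and `stub_twistedComparison_of` (T2) leave the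
composition (they remain landed supports and the intended mechanism for PROVING (X1)); the open registered
stubs are (X1) and `stub_uniformForwardResponseStability` (UFRS), statements unchanged.

References: G. Grimmett, *Percolation* (1999), §2.2 (events determined by disjoint edge sets are
independent under the product measure); H. Duminil-Copin, S. Smirnov, Clay Math. Proc. 15 (2012), §8
(the spin-`1/3` observable and its conjectured `δ^{1/3}` normalisation, Conj. 8.7).
-/

namespace Summit.CriticalPhenomena.CardyFormulaZ2.Cruxes.EdgePrecompact.QkzStripBoundaryArm

open MeasureTheory Filter Set Metric ProbabilityTheory
open scoped Topology BigOperators Pointwise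
open Literature.Probability.LatticeModels Literature.Probability.Percolation
open Literature.Probability.RandomPlanarGeometry (DobrushinDomain)
open Summit.CriticalPhenomena.CardyFormulaZ2.Theses.CardyComplexCone

noncomputable section

/-! ## The all-open event of a finite set of edges -/

/-- "All edges of `K` are open" is the cylinder of the all-open configuration on `K`. -/
theorem allOpen_eq_localCylinder (K : Finset (Sym2 (Site 2))) :
    {ω : BondConfig (Site 2) | ∀ e ∈ K, e ∈ ω} = localCylinder (↑K) (↑K : Set (Sym2 (Site 2))) := by
  ext ω
  simp only [localCylinder, Set.mem_setOf_eq, Finset.mem_coe]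
  exact ⟨fun h e he => ⟨fun _ => he, fun _ => h e he⟩, fun h e he => (h e he).2 he⟩

/-- "All edges of `K` are open" is measurable (a finite cylinder). -/
theorem measurableSet_allOpen (K : Finset (Sym2 (Site 2))) :
    MeasurableSet {ω : BondConfig (Site 2) | ∀ e ∈ K, e ∈ ω} := by
  rw [allOpen_eq_localCylinder]
  exact measurableSet_localCylinder K.finite_toSet.countable _

/-- "All edges of `K` are open" is determined by the edges of `K`. -/
theorem determinedBy_allOpen (K : Finset (Sym2 (Site 2))) :
    DeterminedBy {ω : BondConfig (Site 2) | ∀ e ∈ K, e ∈ ω} (↑K : Set (Sym2 (Site 2))) := by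
  rw [determinedBy_iff]
  intro ω ω' h
  simp only [Set.mem_setOf_eq]
  constructor
  · intro hω e he
    exact ((Set.ext_iff.1 h e).1 ⟨hω e he, Finset.mem_coe.2 he⟩).1
  · intro hω' e he
    exact ((Set.ext_iff.1 h e).2 ⟨hω' e he, Finset.mem_coe.2 he⟩).1

/-- **`P_{1/2}(all edges of K open) = 2^{-|K|}`** for a finite set `K` of genuine lattice edges
(product measure). -/
theorem real_allOpen (K : Finset (Sym2 (Site 2))) (hK : ∀ e ∈ K, e ∈ (zdGraph 2).edgeSet) :
    (bondPercolation (zdGraph 2) half).real {ω : BondConfig (Site 2) | ∀ e ∈ K, e ∈ ω} =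
      (1 / 2 : ℝ) ^ K.card := by
  rw [allOpen_eq_localCylinder, bondPercolation, Russo.setBernoulli_real_localCylinder]
  calc ∏ i ∈ K, Russo.weight (zdGraph 2).edgeSet (↑K) i ((half : unitInterval) : ℝ)
      = ∏ _i ∈ K, (1 / 2 : ℝ) :=
        Finset.prod_congr rfl fun e he => by simp [Russo.weight, Finset.mem_coe.2 he, hK e he]
    _ = (1 / 2 : ℝ) ^ K.card := Finset.prod_const _

/-- **Measurability off a ball.** If the edges of `K` have their midpoints outside the ball `B(z, ρ)`,
then "all edges of `K` are open" is measurable for the σ-algebra of the configuration OFF that ball,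
`MeasurableSpace.comap (fun ω => ω \ {e | medialPoint δ e ∈ ball z ρ})` (the exterior σ-algebra of the
stub `stub_localInnerEnvelopeUI`). -/
theorem measurableSet_comap_allOpen {δ : ℝ} {z : ℂ} {ρ : ℝ} {K : Finset (Sym2 (Site 2))}
    (hfar : ∀ e ∈ K, medialPoint δ e ∉ ball z ρ) :
    MeasurableSet[MeasurableSpace.comap
      (fun ω : BondConfig (Site 2) => ω \ {e | medialPoint δ e ∈ ball z ρ})
      (inferInstance : MeasurableSpace (BondConfig (Site 2)))] {ω : BondConfig (Site 2) | ∀ e ∈ K, e ∈ ω} := by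
  refine ⟨{ω | ∀ e ∈ K, e ∈ ω}, measurableSet_allOpen K, ?_⟩
  ext ω
  simp only [Set.mem_preimage, Set.mem_setOf_eq, Set.mem_sdiff]
  exact forall₂_congr fun e he => ⟨fun h => h.1, fun h => ⟨h, hfar e he⟩⟩

/-- **Independence from the domain (thinning identity).** For admissible data `E` and a finite set `K`
of edges disjoint from the edges of `Ω_δ`, the restricted expectation of the dart phase sum over "all
edges of `K` open" is `P(all open) · E[F]`: the phase sum reads only the edges of `Ω_δ`
(`medialExploration_inter_eq`), the event only the edges of `K`, and disjoint edge sets are independent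
under `P_{1/2}` (Grimmett 1999, §2.2). -/
theorem setIntegral_allOpen_eq {E : DiscreteDobrushin} (hE : E.IsZdAdmissible) {K : Finset (Sym2 (Site 2))}
    (hdisj : Disjoint (↑K : Set (Sym2 (Site 2))) (discreteDomainGraph E.Ω E.δ).edgeSet)
    (σ : ℝ) (c : Site 2 × Site 2) :
    ∫ ω in {ω : BondConfig (Site 2) | ∀ e ∈ K, e ∈ ω}, dartPhaseSum (medialExploration E ω) E.δ σ c
        ∂(bondPercolation (zdGraph 2) half) =
      ((bondPercolation (zdGraph 2) half).real {ω : BondConfig (Site 2) | ∀ e ∈ K, e ∈ ω} : ℂ) *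
        ∫ ω, dartPhaseSum (medialExploration E ω) E.δ σ c ∂(bondPercolation (zdGraph 2) half) := by
  set μ := bondPercolation (zdGraph 2) half with hμ
  set A : Set (BondConfig (Site 2)) := {ω | ∀ e ∈ K, e ∈ ω} with hA
  set F : BondConfig (Site 2) → ℂ := fun ω => dartPhaseSum (medialExploration E ω) E.δ σ c with hF
  set X : BondConfig (Site 2) → ℂ := A.indicator 1 with hX
  have hAm : MeasurableSet A := measurableSet_allOpen K
  have hFm : Measurable F := measurable_dartPhaseSum_medialExploration hE E.δ σ c
  have hXm : Measurable X := measurable_one.indicator hAm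
  -- `σ(K)`- and `σ(edges of Ω_δ)`-measurability
  have hXσ : Measurable[edgeSigma (↑K : Set (Sym2 (Site 2)))] X :=
    (measurable_const (a := (1 : ℂ))).indicator ((determinedBy_allOpen K).measurableSet_edgeSigma hAm)
  have hFσ : Measurable[edgeSigma (discreteDomainGraph E.Ω E.δ).edgeSet] F :=
    measurable_edgeSigma_of_forall_inter hFm _ fun ω => by
      simp only [hF, medialExploration_inter_eq E subset_rfl ω]
  -- independence of `X` and `F`
  have hind : IndepFun X F μ := by
    rw [IndepFun_iff_Indep]
    exact indep_of_indep_of_le (bondPercolation_indep_edgeSigma (zdGraph 2) half hdisj)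
      (measurable_iff_comap_le.1 hXσ) (measurable_iff_comap_le.1 hFσ)
  -- the restricted integral is the integral of `X * F`
  have hprod : ∫ ω in A, F ω ∂μ = ∫ ω, X ω * F ω ∂μ := by
    rw [← integral_indicator hAm]
    refine integral_congr_ae (Eventually.of_forall fun ω => ?_)
    by_cases hω : ω ∈ A <;> simp [hX, Set.indicator, hω]
  have hXint : ∫ ω, X ω ∂μ = ((μ.real A : ℝ) : ℂ) := by
    rw [hX, integral_indicator hAm]
    simp only [Pi.one_apply, setIntegral_const, Complex.real_smul, mul_one]
  rw [hprod, hind.integral_fun_mul_eq_mul_integral hXm.aestronglyMeasurable hFm.aestronglyMeasurable, hXint]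

/-! ## Far edges exist -/

/-- **Far edges.** For admissible data (bounded domain, positive mesh) and every `k` there is a set of `k`
genuine lattice edges disjoint from the edges of `Ω_δ` whose midpoints lie outside `E.Ω` (hence outside
every ball contained in `E.Ω`): the horizontal edges `{(N+j, 0), (N+j+1, 0)}`, `j < k`, for `δN` beyond
a ball about `0` containing `Ω`. -/
theorem exists_farEdges {E : DiscreteDobrushin} (hE : E.IsZdAdmissible) (k : ℕ) :
    ∃ K : Finset (Sym2 (Site 2)), K.card = k ∧ (∀ e ∈ K, e ∈ (zdGraph 2).edgeSet) ∧
      Disjoint (↑K : Set (Sym2 (Site 2))) (discreteDomainGraph E.Ω E.δ).edgeSet ∧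
      ∀ e ∈ K, medialPoint E.δ e ∉ E.Ω := by
  have hδ : 0 < E.δ := hE.delta_pos
  obtain ⟨r, hr⟩ := (isBounded_iff_subset_ball (0 : ℂ)).1 hE.isBounded
  -- an abscissa `N ≥ 0` with `δ N ≥ r`
  obtain ⟨N, hN0, hNr⟩ : ∃ N : ℕ, (0 : ℝ) ≤ N ∧ r ≤ E.δ * N := by
    obtain ⟨N, hN⟩ := exists_nat_ge (r / E.δ)
    exact ⟨N, N.cast_nonneg, by rwa [div_le_iff₀' hδ] at hN⟩
  -- the far sites and edges
  let x : ℕ → Site 2 := fun j => ![(N : ℤ) + j, 0]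
  have hx0 : ∀ j, x j 0 = (N : ℤ) + j := fun j => rfl
  have hxsucc : ∀ j, x (j + 1) = x j + Pi.single 0 1 := fun j => by
    ext i; fin_cases i <;> simp [x]; ring
  have hxnorm : ∀ j, E.δ * N ≤ ‖meshPoint E.δ (x j)‖ := fun j => by
    refine le_trans ?_ (Complex.abs_re_le_norm _)
    rw [meshPoint_re, hx0]
    push_cast
    rw [abs_of_nonneg (by positivity)]
    nlinarith [Nat.cast_nonneg (α := ℝ) j]
  have hxinj : Function.Injective x := fun j j' h => by
    have := congrFun h 0
    rw [hx0, hx0] at this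
    exact_mod_cast (add_right_inj _).1 this
  let e : ℕ → Sym2 (Site 2) := fun j => s(x j, x (j + 1))
  have heinj : Function.Injective e := fun j j' h => by
    rcases Sym2.eq_iff.1 h with ⟨h1, -⟩ | ⟨h1, h2⟩
    · exact hxinj h1
    · have a := congrFun h1 0
      have b := congrFun h2 0
      simp only [hx0] at a b
      push_cast at a b
      have : (j : ℤ) = j' := by linarith
      exact_mod_cast this
  refine ⟨(Finset.range k).image e, ?_, ?_, ?_, ?_⟩
  · rw [Finset.card_image_of_injective _ heinj, Finset.card_range]
  · intro e' he'
    obtain ⟨j, -, rfl⟩ := Finset.mem_image.1 he'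
    rw [SimpleGraph.mem_edgeSet, zdGraph_adj_iff]
    exact ⟨0, Or.inl (hxsucc j)⟩
  · rw [Set.disjoint_left]
    intro e' he' hdom
    obtain ⟨j, -, rfl⟩ := Finset.mem_image.1 (Finset.mem_coe.1 he')
    rw [SimpleGraph.mem_edgeSet, discreteDomainGraph_adj_iff] at hdom
    have h1 := hr (meshDomain_subset_meshVertices _ _ hdom.2.1)
    rw [mem_ball, dist_zero_right] at h1
    linarith [hxnorm j]
  · intro e' he' hmem
    obtain ⟨j, -, rfl⟩ := Finset.mem_image.1 he'
    have h1 := hr hmem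
    rw [mem_ball, dist_zero_right, medialPoint_mk] at h1
    -- the midpoint of two points of real part `≥ δN` has real part `≥ δN ≥ r`
    have h2 : E.δ * N ≤ ‖(meshPoint E.δ (x j) + meshPoint E.δ (x (j + 1))) / 2‖ := by
      refine le_trans ?_ (Complex.abs_re_le_norm _)
      simp only [Complex.div_ofNat_re, Complex.add_re, meshPoint_re, hx0]
      push_cast
      rw [abs_of_nonneg (by positivity)]
      nlinarith [Nat.cast_nonneg (α := ℝ) j]
    linarith

/-! ## The inner envelope from (X1) -/

/-- **(X1) ⇒ the inner envelope on every ball**, for all admissible data. HYPOTHESIS: the registered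
stub `stub_localInnerEnvelopeUI` (X1) verbatim. CONCLUSION: one constant `C ≥ 0` with
`‖cornerObs E E.δ v f‖ ≤ C (E.δ/ρ)^{1/3}` for every admissible `E`, every corner `(v,f)` and every radius
`ρ ≥ E.δ` with `closedBall (δv) ρ ⊆ E.Ω`. Proof: thinning by `k` far open edges with `2^{-k} ≤ ε'(1)`,
`C = 2^k`. -/
theorem innerEnvelope_of_localInnerEnvelopeUI : (∀ ε₁ > (0:ℝ), ∃ ε' > (0:ℝ), ∀ (E : DiscreteDobrushin), E.IsZdAdmissible → ∀ v f : Site 2, IsCorner v f → ∀ ρ : ℝ, E.δ ≤ ρ → closedBall (meshPoint E.δ v) ρ ⊆ E.Ω → ∀ A : Set (BondConfig (Site 2)), MeasurableSet[MeasurableSpace.comap (fun ω : BondConfig (Site 2) => ω \ {e | medialPoint E.δ e ∈ ball (meshPoint E.δ v) ρ}) (inferInstance : MeasurableSpace (BondConfig (Site 2)))] A → (bondPercolation (zdGraph 2) half).real A ≤ ε' → ‖∫ ω in A, dartPhaseSum (medialExploration E ω) E.δ (1 / 3) (v, f) ∂(bondPercolation (zdGraph 2) half)‖ ≤ ε₁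 * (E.δ / ρ) ^ ((1:ℝ) / 3)) → ∃ C : ℝ, 0 ≤ C ∧ ∀ (E : DiscreteDobrushin), E.IsZdAdmissible → ∀ v f : Site 2, IsCorner v f → ∀ ρ : ℝ, E.δ ≤ ρ → closedBall (meshPoint E.δ v) ρ ⊆ E.Ω → ‖cornerObs E E.δ v f‖ ≤ C * (E.δ / ρ) ^ ((1:ℝ) / 3) := by
  intro hX1
  obtain ⟨ε', hε', h⟩ := hX1 1 one_pos
  -- `k` with `2^{-k} ≤ ε'`
  obtain ⟨k, hk⟩ : ∃ k : ℕ, (1 / 2 : ℝ) ^ k ≤ ε' :=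
    (exists_pow_lt_of_lt_one hε' (by norm_num : (1 / 2 : ℝ) < 1)).imp fun _ hk => hk.le
  refine ⟨2 ^ k, by positivity, fun E hE v f hvf ρ hρ hball => ?_⟩
  obtain ⟨K, hcard, hKedge, hdisj, hfarΩ⟩ := exists_farEdges hE k
  -- the far edges are outside the ball (which lies inside `Ω`)
  have hfar : ∀ e ∈ K, medialPoint E.δ e ∉ ball (meshPoint E.δ v) ρ :=
    fun e he hmem => hfarΩ e he (hball (ball_subset_closedBall hmem))
  -- apply (X1) to `A :=` "all edges of `K` open"
  have hpos : (0 : ℝ) < (1 / 2 : ℝ) ^ k := by positivity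
  have key := h E hE v f hvf ρ hρ hball {ω | ∀ e ∈ K, e ∈ ω} (measurableSet_comap_allOpen hfar)
    (by rw [real_allOpen K hKedge, hcard]; exact hk)
  rw [setIntegral_allOpen_eq hE hdisj, real_allOpen K hKedge, hcard, norm_mul,
    ← cornerObs_eq_integral_dartPhaseSum, one_mul, Complex.norm_real, Real.norm_eq_abs,
    abs_of_pos hpos] at key
  -- `(1/2)^k ‖cornerObs‖ ≤ (δ/ρ)^{1/3}` ⇒ `‖cornerObs‖ ≤ 2^k (δ/ρ)^{1/3}`
  have h2k : (2 : ℝ) ^ k * (1 / 2 : ℝ) ^ k = 1 := by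
    rw [← mul_pow]; norm_num
  calc ‖cornerObs E E.δ v f‖ = (2 : ℝ) ^ k * ((1 / 2 : ℝ) ^ k * ‖cornerObs E E.δ v f‖) := by
        rw [← mul_assoc, h2k, one_mul]
    _ ≤ (2 : ℝ) ^ k * (E.δ / ρ) ^ ((1:ℝ) / 3) := mul_le_mul_of_nonneg_left key (by positivity)

/-- **(X1) ⇒ `UniformInnerEnvelope`** (the junction of the line, now reached without the (T2)/(P)
stubs). At lattice depth `R ≥ 2` in a Jordan Dobrushin domain the closed ball of radius `ρ = Rδ/2 ≥ δ`
about `δv` lies in `Ω` (it lies in the open ball of radius `Rδ ≤ dist(δv, Ωᶜ)`), and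
`(δ/ρ)^{1/3} = 2^{1/3} R^{-1/3}`; at `R = 1` the trivial bound `‖cornerObs‖ ≤ 1` suffices. -/
theorem uniformInnerEnvelope_of_localInnerEnvelopeUI : (∀ ε₁ > (0:ℝ), ∃ ε' > (0:ℝ), ∀ (E : DiscreteDobrushin), E.IsZdAdmissible → ∀ v f : Site 2, IsCorner v f → ∀ ρ : ℝ, E.δ ≤ ρ → closedBall (meshPoint E.δ v) ρ ⊆ E.Ω → ∀ A : Set (BondConfig (Site 2)), MeasurableSet[MeasurableSpace.comap (fun ω : BondConfig (Site 2) => ω \ {e | medialPoint E.δ e ∈ ball (meshPoint E.δ v) ρ}) (inferInstance : MeasurableSpace (BondConfig (Site 2)))] A → (bondPercolation (zdGraph 2) half).real A ≤ ε' → ‖∫ ω in A, dartPhaseSum (medialExploration E ω) E.δ (1 / 3) (v, f) ∂(bondPercolation (zdGraph 2) half)‖ ≤ ε₁ * (E.δ / ρ) ^ ((1:ℝ) / 3)) → UniformInnerEnvelope := by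
  intro hX1
  obtain ⟨C, hC0, hC⟩ := innerEnvelope_of_localInnerEnvelopeUI hX1
  refine ⟨max (C * (2 : ℝ) ^ ((1:ℝ) / 3)) 1, fun D E hΩ hE v f hvf R hR hdepth => ?_⟩
  have hδ : 0 < E.δ := hE.delta_pos
  have hRpos : (0 : ℝ) < R := by exact_mod_cast hR
  have hRpow : 0 < (R : ℝ) ^ (-(1:ℝ) / 3) := Real.rpow_pos_of_pos hRpos _
  rcases Nat.lt_or_ge R 2 with hR1 | hR2
  · -- `R = 1`: the trivial envelope
    have hR1' : R = 1 := by omega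
    subst hR1'
    calc ‖cornerObs E E.δ v f‖ ≤ 1 := norm_cornerObs_le_one E E.δ v f
      _ ≤ max (C * (2 : ℝ) ^ ((1:ℝ) / 3)) 1 * ((1 : ℕ) : ℝ) ^ (-(1:ℝ) / 3) := by
          rw [Nat.cast_one, Real.one_rpow, mul_one]; exact le_max_right _ _
  · -- `R ≥ 2`: the ball of radius `Rδ/2`
    set ρ : ℝ := (R : ℝ) * E.δ / 2 with hρdef
    have hρδ : E.δ ≤ ρ := by
      have : (2 : ℝ) ≤ R := by exact_mod_cast hR2
      rw [hρdef]; nlinarith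
    have hρpos : 0 < ρ := lt_of_lt_of_le hδ hρδ
    have hball : closedBall (meshPoint E.δ v) ρ ⊆ E.Ω := by
      intro y hy
      rw [hΩ]
      by_contra hyD
      have h1 : infDist (meshPoint E.δ v) D.carrierᶜ ≤ dist (meshPoint E.δ v) y :=
        infDist_le_dist_of_mem (mem_compl hyD)
      rw [mem_closedBall, dist_comm] at hy
      have : (R : ℝ) * E.δ ≤ ρ := hdepth.trans (h1.trans hy)
      rw [hρdef] at this
      nlinarith
    have key := hC E hE v f hvf ρ hρδ hball
    have hratio : (E.δ / ρ) ^ ((1:ℝ) / 3) = (2 : ℝ) ^ ((1:ℝ) / 3) * (R : ℝ) ^ (-(1:ℝ) / 3) := by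
      have h1 : E.δ / ρ = 2 * (R : ℝ)⁻¹ := by
        rw [hρdef]; field_simp
      rw [h1, Real.mul_rpow (by norm_num) (by positivity), Real.inv_rpow hRpos.le,
        ← Real.rpow_neg hRpos.le]
      norm_num
    calc ‖cornerObs E E.δ v f‖ ≤ C * (E.δ / ρ) ^ ((1:ℝ) / 3) := key
      _ = C * (2 : ℝ) ^ ((1:ℝ) / 3) * (R : ℝ) ^ (-(1:ℝ) / 3) := by rw [hratio]; ring
      _ ≤ max (C * (2 : ℝ) ^ ((1:ℝ) / 3)) 1 * (R : ℝ) ^ (-(1:ℝ) / 3) :=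
          mul_le_mul_of_nonneg_right (le_max_left _ _) hRpow.le

end

end Summit.CriticalPhenomena.CardyFormulaZ2.Cruxes.EdgePrecompact.QkzStripBoundaryArm
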